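import Literature.AlgebraicGeometry.Motives.DworkFamily
import Literature.AlgebraicGeometry.HodgeTheory.DworkSexticEigenspaces
import HarnessLib

/-!
# Complex points of the Dwork family: the diagonal action in homogeneous coordinates

For the Dwork hypersurface `X_ψ = X_ψ(W, d) = V₊(Σ wᵢxᵢᵈ − dψx^W) ⊂ ℙⁿ⁺¹_ℂ`
(`Motives/DworkFamily`) and `ζ ∈ Γ_W = {ζ ∈ μ_d^{n+2} | ∏ ζⱼ^{wⱼ} = 1}`, the `ℂ`-automorphism
`dworkDiagHom ζ : X_ψ → X_ψ`, `xⱼ ↦ ζⱼxⱼ` (Katz 2009, §3) induces a continuous self-map of the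
complex points `X_ψ(ℂ)` (strong topology, `Motives.AlgPoints.mapContinuous`), and through the
homogeneous-coordinate embedding `pt = hypersurfacePoint (hypersurfaceι F) : X_ψ(ℂ) → ℙ(ℂⁿ⁺²)`
(`HodgeTheory/HypersurfaceComplexPoints`, Serre GAGA §2 n°5) it acts by **`[z] ↦ [ζ·z]`**:
`rep (pt (g x)) = t • (ζ * rep (pt x))` for a scalar `t` (`exists_rep_hypersurfacePoint_dworkDiagHom`,
`exists_continuousMap_dworkDiag`). This is the form in which a diagonal symmetry is recognised on
singular cohomology `H•(X_ψ(ℂ))` (eigenspace decompositions under `Γ_W/Δ`, Katz 2009 §3).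

The mechanism is general and proved here for any embedded `ℂ`-scheme: if `g : Y → Y` and
`ι : Y → ℙⁿ⁺¹_ℂ` satisfy `g ≫ ι = ι ≫ substMap τ` for an invertible linear substitution `τ`
(`Motives/ProjectiveSpaceLinearSubst`), then `pt (g P) = [τ(rep (pt P))]`
(`hypersurfacePoint_map_of_comp_eq`), because on complex points of `ℙⁿ⁺¹_ℂ` the projective linear
transformation is `[z] ↦ [τ(z)]` (`map_substMap_projPoint_mk`: both points lie in the same basic
opens `D₊(g)`, `substMap⁻¹D₊(g) = D₊(σ_τ g)`).

**Bridge to the sextic fourfold file** (`HodgeTheory/DworkSexticEigenspaces`, the carriers of route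
`DworkPrymHodge`): `DworkSextic.form ψ = dworkFamilyForm 1 6 ψ` (`DworkSextic.form_eq_dworkFamilyForm`),
`DworkSextic.fibre ψ = dworkHypersurface 1 6 ψ`; the symmetry `a ∈ Γ_W = {a ∈ μ₆⁶ | ∏ aᵢ = 1}` of
the fibre as a `ℂ`-scheme AUTOMORPHISM `DworkSextic.diagIso ψ a` (no transport: it is
`SmoothHypersurface.substLiftIso` of the sextic form itself), acting on `X_ψ(ℂ)` by `[x] ↦ [a • x]`
(`DworkSextic.exists_rep_pt_diagIso`), so that — the realising continuous map being unique,
`DworkSextic.symmetry_unique` — every continuous self-map of `X_ψ(ℂ)` realising `a` (the maps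
quantified over in `DworkSextic.IsEig` / `HasSymmetry`) is the analytification of this algebraic
automorphism (`DworkSextic.eq_mapContinuous_diagIso`).

## References

* N. M. Katz, *Another look at the Dwork family*, Progr. Math. 270 (2009), 89–126, §3. [Katz2009]
* J.-P. Serre, *Géométrie algébrique et géométrie analytique*, Ann. Inst. Fourier 6 (1956), §2 n°5.
  [SerreGAGA1956]
-/

noncomputable section

open scoped LinearAlgebra.Projectivization
open CategoryTheory AlgebraicGeometry MvPolynomial

namespace Literature.AlgebraicGeometry.HodgeTheory

open Literature.NumberTheory.Transcendental Literature.AlgebraicGeometry.Motives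

attribute [local instance] MvPolynomial.gradedAlgebra

variable {n : ℕ}

/-- The grading of `ℂ[x₀, …, x_{n+1}]` by degree (local notation, as in `HypersurfaceComplexPoints`).
[folklore] -/
local notation "𝓐" => MvPolynomial.homogeneousSubmodule (Fin (n + 2)) ℂ

/-! ### Projective linear transformations on complex points of `ℙⁿ⁺¹_ℂ` -/

section SubstMap

variable (τ : Fin (n + 2) → MvPolynomial (Fin (n + 2)) ℂ) (hτ : ∀ j, (τ j).IsHomogeneous 1)
  (τ' : Fin (n + 2) → MvPolynomial (Fin (n + 2)) ℂ) (hτ' : ∀ j, (τ' j).IsHomogeneous 1)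
  (hinv : ∀ p, aeval τ (aeval τ' p) = p)

/-- **`substMap τ` on complex points is `[z] ↦ [τ(z)]`** through the comparison `projPoint`
(`ℙⁿ⁺¹(ℂ) = ℙⁿ⁺¹_ℂ(ℂ)`): both sides lie in the same basic opens `D₊(g)`
(`substMap⁻¹ D₊(g) = D₊(σ_τ g)` and `(σ_τ g)(z) = g(τ(z))`), and complex points of `ℙⁿ⁺¹_ℂ` are
determined by that (`Proj.ext_of_forall_mem_basicOpen_iff`, `ComplexPoints.ext_of_pt_eq`).
[cite: Hartshorne1977, II Ex. 2.14] -/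
theorem map_substMap_projPoint_mk (z : Fin (n + 2) → ℂ) (hz : z ≠ 0) :
    Motives.AlgPoints.map (ProjectiveSpace.substMap τ hτ τ' hτ' hinv)
        (projPoint (n + 1) (Projectivization.mk ℂ z hz)) =
      projPoint (n + 1) (Projectivization.mk ℂ (ProjectiveSpace.substVec τ z)
        (ProjectiveSpace.substVec_ne_zero τ τ' hτ' hinv hz)) := by
  refine Motives.ComplexPoints.ext_of_pt_eq
    (Proj.ext_of_forall_mem_basicOpen_iff 𝓐 fun m hm g hg => ?_)
  refine Iff.trans ?_ (pt_projPoint_mk_mem_basicOpen_iff (n + 1) _ _ hm hg).symm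
  -- `(substMap [z]).pt ∈ D₊(g)` is `[z].pt ∈ substMap⁻¹ D₊(g) = D₊(σ_τ g)` by definition
  refine (pt_projPoint_mk_mem_basicOpen_iff (n + 1) z hz hm
    ((ProjectiveSpace.substGraded τ hτ).map_mem hg)).trans ?_
  have e : ∀ (w : Fin (n + 2) → ℂ) (q : MvPolynomial (Fin (n + 2)) ℂ), eval w q = aeval w q :=
    fun _ _ => rfl
  rw [e, e]
  -- the membership proof `(substGraded τ hτ).map_mem hg` spells `σ_τ g` through `toRingHom`
  show aeval z (ProjectiveSpace.substGraded τ hτ g) ≠ 0 ↔ _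
  rw [ProjectiveSpace.aeval_substGraded_eq]

/-- **An endomorphism compatible with a projective linear transformation acts on homogeneous
coordinates by the substitution**: for `g : Y → Y` and `ι : Y → ℙⁿ⁺¹_ℂ` over `ℂ` with
`g ≫ ι = ι ≫ substMap τ`, the complex point `g(P)` has homogeneous coordinates `τ(z)` where `z`
are those of `P` (`hypersurfacePoint ι (g P) = [τ(rep (hypersurfacePoint ι P))]`).
[cite: SerreGAGA1956, §2 n°5] -/
theorem hypersurfacePoint_map_of_comp_eq {Y : Motives.SchemeOver ℂ}
    (ι : Y ⟶ Motives.projectiveSpace (n + 1) ℂ) (g : Y ⟶ Y)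
    (hg : g ≫ ι = ι ≫ ProjectiveSpace.substMap τ hτ τ' hτ' hinv) (P : Motives.ComplexPoints Y) :
    hypersurfacePoint ι (Motives.AlgPoints.map g P) =
      Projectivization.mk ℂ (ProjectiveSpace.substVec τ (hypersurfacePoint ι P).rep)
        (ProjectiveSpace.substVec_ne_zero τ τ' hτ' hinv (hypersurfacePoint ι P).rep_nonzero) := by
  apply hypersurfacePoint_eq_of_projPoint_eq
  rw [← Motives.AlgPoints.map_comp_apply, hg, Motives.AlgPoints.map_comp_apply,
    ← projPoint_hypersurfacePoint ι P]
  conv_rhs => rw [← Projectivization.mk_rep (hypersurfacePoint ι P)]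
  exact (map_substMap_projPoint_mk τ hτ τ' hτ' hinv _ _).symm

/-- The same in the form «`rep (pt (g P)) = t • τ(rep (pt P))` for some `t ≠ 0`» (representatives
of a point of `ℙ(ℂⁿ⁺²)` are determined up to `ℂˣ`). [cite: SerreGAGA1956, §2 n°5] -/
theorem exists_rep_hypersurfacePoint_map_of_comp_eq {Y : Motives.SchemeOver ℂ}
    (ι : Y ⟶ Motives.projectiveSpace (n + 1) ℂ) (g : Y ⟶ Y)
    (hg : g ≫ ι = ι ≫ ProjectiveSpace.substMap τ hτ τ' hτ' hinv) (P : Motives.ComplexPoints Y) :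
    ∃ t : ℂ, t ≠ 0 ∧ (hypersurfacePoint ι (Motives.AlgPoints.map g P)).rep =
      t • ProjectiveSpace.substVec τ (hypersurfacePoint ι P).rep := by
  have h := hypersurfacePoint_map_of_comp_eq τ hτ τ' hτ' hinv ι g hg P
  have hmk := (Projectivization.mk_rep (hypersurfacePoint ι (Motives.AlgPoints.map g P))).trans h
  obtain ⟨a, ha⟩ := (Projectivization.mk_eq_mk_iff ℂ _ _ _ _).mp hmk
  exact ⟨a, a.ne_zero, by rw [← ha, Units.smul_def]⟩

end SubstMap

/-! ### The diagonal action on `X_ψ(ℂ)` -/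

section Dwork

variable (W : Fin (n + 2) → ℕ) {d : ℕ} (ψ : ℂ)

/-- **`ζ ∈ Γ_W` acts on the complex points of the Dwork hypersurface by `[z] ↦ [ζ·z]`**: for the
continuous self-map `g = (dworkDiagHom ζ)(ℂ)` of `X_ψ(ℂ)` and `pt = hypersurfacePoint (hypersurfaceι F_ψ)`,
`rep (pt (g x)) = t • (ζ * rep (pt x))` for some `t ≠ 0`. [cite: Katz2009, §3] -/
theorem exists_rep_hypersurfacePoint_dworkDiagHom (hd : d ≠ 0) (ζ : Fin (n + 2) → ℂ)
    (hζd : ∀ j, ζ j ^ d = 1) (hζW : ∏ j, ζ j ^ W j = 1)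
    (x : Motives.ComplexPoints (Motives.dworkHypersurface W d ψ)) :
    ∃ t : ℂ, t ≠ 0 ∧
      (hypersurfacePoint (SmoothHypersurface.hypersurfaceι (dworkFamilyForm W d ψ))
          (Motives.AlgPoints.mapContinuous (Motives.dworkDiagHom W ψ hd ζ hζd hζW) x)).rep =
        t • (ζ * (hypersurfacePoint (SmoothHypersurface.hypersurfaceι (dworkFamilyForm W d ψ)) x).rep) := by
  obtain ⟨t, ht, h⟩ := exists_rep_hypersurfacePoint_map_of_comp_eq (ProjectiveSpace.diagSubst ζ)
    (ProjectiveSpace.isHomogeneous_diagSubst ζ) (ProjectiveSpace.diagSubst fun j => (ζ j)⁻¹)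
    (ProjectiveSpace.isHomogeneous_diagSubst _)
    (ProjectiveSpace.aeval_diagSubst_diagSubst_inv (Motives.ne_zero_of_pow_eq_one hd hζd))
    (SmoothHypersurface.hypersurfaceι (dworkFamilyForm W d ψ)) (Motives.dworkDiagHom W ψ hd ζ hζd hζW)
    (Motives.dworkDiagHom_comp_hypersurfaceι W ψ hd ζ hζd hζW) x
  refine ⟨t, ht, h.trans ?_⟩
  rw [ProjectiveSpace.substVec_diagSubst]
  rfl

/-- **Existence of the diagonal symmetry on complex points** (the shape consumed downstream): for
every `ζ` with `ζⱼᵈ = 1`, `∏ ζⱼ^{wⱼ} = 1` there is a continuous self-map `g` of `X_ψ(ℂ)` acting as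
`x ↦ ζ·x` on homogeneous coordinates. [cite: Katz2009, §3] -/
theorem exists_continuousMap_dworkDiag (hd : d ≠ 0) (ζ : Fin (n + 2) → ℂ) (hζd : ∀ j, ζ j ^ d = 1)
    (hζW : ∏ j, ζ j ^ W j = 1) :
    ∃ g : C(Motives.ComplexPoints (Motives.dworkHypersurface W d ψ),
        Motives.ComplexPoints (Motives.dworkHypersurface W d ψ)),
      ∀ x, ∃ t : ℂ,
        (hypersurfacePoint (SmoothHypersurface.hypersurfaceι (dworkFamilyForm W d ψ)) (g x)).rep =
          t • (ζ * (hypersurfacePoint (SmoothHypersurface.hypersurfaceι (dworkFamilyForm W d ψ)) x).rep) :=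
  ⟨Motives.AlgPoints.mapContinuous (Motives.dworkDiagHom W ψ hd ζ hζd hζW), fun x =>
    let ⟨t, _, h⟩ := exists_rep_hypersurfacePoint_dworkDiagHom W ψ hd ζ hζd hζW x
    ⟨t, h⟩⟩

/-- The same for a hypersurface *presented* by a form `F` equal to the Dwork form (e.g. the literal
`(Σ xᵢ⁶) − C(6ψ)∏xᵢ = dworkFamilyForm 1 6 ψ`, `Motives/DworkFamily.dworkFamilyForm_one`): the
statement transported along `F = F_ψ`, so that no rewriting inside the types `X_F(ℂ)` is needed
downstream. [cite: Katz2009, §3] -/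
theorem exists_continuousMap_diag_of_eq {F : MvPolynomial (Fin (n + 2)) ℂ}
    (hF : F = dworkFamilyForm W d ψ) (hd : d ≠ 0) (ζ : Fin (n + 2) → ℂ) (hζd : ∀ j, ζ j ^ d = 1)
    (hζW : ∏ j, ζ j ^ W j = 1) :
    ∃ g : C(Motives.ComplexPoints (SmoothHypersurface.hypersurface F),
        Motives.ComplexPoints (SmoothHypersurface.hypersurface F)),
      ∀ x, ∃ t : ℂ,
        (hypersurfacePoint (SmoothHypersurface.hypersurfaceι F) (g x)).rep =
          t • (ζ * (hypersurfacePoint (SmoothHypersurface.hypersurfaceι F) x).rep) := by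
  subst hF
  exact exists_continuousMap_dworkDiag W ψ hd ζ hζd hζW

end Dwork

/-! ### The sextic fourfold pencil: bridge to `DworkSexticEigenspaces` -/

namespace DworkSextic

/-- **The sextic form is the Dwork family form with `W = 1`, `d = 6`**:
`DworkSextic.form ψ = dworkFamilyForm 1 6 ψ` (`Motives/DworkFamily.dworkFamilyForm_one`, up to the
cast `((6 : ℕ) : ℂ) = 6`). [cite: Katz2009, §2] -/
theorem form_eq_dworkFamilyForm (ψ : ℂ) : form ψ = dworkFamilyForm (1 : Fin 6 → ℕ) 6 ψ := by
  rw [dworkFamilyForm_one]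
  norm_num

/-- The fibre `X_ψ` of the sextic pencil is the member `dworkHypersurface 1 6 ψ` of the Dwork family.
[cite: Katz2009, §2] -/
theorem fibre_eq_dworkHypersurface (ψ : ℂ) :
    fibre ψ = Motives.dworkHypersurface (1 : Fin 6 → ℕ) 6 ψ := by
  rw [Motives.dworkHypersurface_eq, ← form_eq_dworkFamilyForm]

/-- `Γ_W`-invariance of the sextic form under `xⱼ ↦ aⱼxⱼ` (`aⱼ⁶ = 1`, `∏ aⱼ = 1`), as an identity
of polynomials (`aeval` of the diagonal substitution; compare `eval_mul_form`, the identity of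
values). [cite: Katz2009, §3] -/
theorem aeval_diagSubst_form (ψ : ℂ) {a : Fin 6 → ℂ} (ha : ∀ i, a i ^ 6 = 1)
    (hprod : ∏ i, a i = 1) : aeval (ProjectiveSpace.diagSubst a) (form ψ) = form ψ := by
  rw [form_eq_dworkFamilyForm]
  exact Motives.aeval_diagSubst_dworkFamilyForm (1 : Fin 6 → ℕ) ψ a ha (by simpa using hprod)

/-- `Γ_W`-invariance under the inverse element `a⁻¹`. [cite: Katz2009, §3] -/
theorem aeval_diagSubst_inv_form (ψ : ℂ) {a : Fin 6 → ℂ} (ha : ∀ i, a i ^ 6 = 1)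
    (hprod : ∏ i, a i = 1) : aeval (ProjectiveSpace.diagSubst fun j => (a j)⁻¹) (form ψ) = form ψ := by
  rw [form_eq_dworkFamilyForm]
  exact Motives.aeval_diagSubst_inv_dworkFamilyForm (1 : Fin 6 → ℕ) ψ a ha (by simpa using hprod)

/-- A sixth root of unity is non-zero. [folklore] -/
theorem ne_zero_of_pow_six {a : Fin 6 → ℂ} (ha : ∀ i, a i ^ 6 = 1) (j : Fin 6) : a j ≠ 0 :=
  Motives.ne_zero_of_pow_eq_one (d := 6) (by norm_num) ha j

/-- **The symmetry `a ∈ Γ_W` of the sextic fibre as a `ℂ`-scheme automorphism `X_ψ ≅ X_ψ`**,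
`xⱼ ↦ aⱼxⱼ` (the restriction `SmoothHypersurface.substLiftIso` of the diagonal projective
transformation of `ℙ⁵` to the reduced hypersurface; Katz, §3: «The group `Γ_W` acts as
automorphisms of `𝕏/𝔸¹`»). [cite: Katz2009, §3] -/
def diagIso (ψ : ℂ) (a : Fin 6 → ℂ) (ha : ∀ i, a i ^ 6 = 1) (hprod : ∏ i, a i = 1) :
    fibre ψ ≅ fibre ψ :=
  Motives.SmoothHypersurface.substLiftIso (form ψ) (ProjectiveSpace.diagSubst a)
    (ProjectiveSpace.isHomogeneous_diagSubst a) (ProjectiveSpace.diagSubst fun j => (a j)⁻¹)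
    (ProjectiveSpace.isHomogeneous_diagSubst _)
    (ProjectiveSpace.aeval_diagSubst_diagSubst_inv (ne_zero_of_pow_six ha))
    (aeval_diagSubst_form ψ ha hprod)
    (ProjectiveSpace.aeval_diagSubst_inv_diagSubst (ne_zero_of_pow_six ha))
    (aeval_diagSubst_inv_form ψ ha hprod)

/-- `diagIso` is the restriction of the diagonal transformation of `ℙ⁵_ℂ`:
`(diagIso a).hom ≫ ι = ι ≫ diagMap a`. [cite: Katz2009, §3] -/
theorem diagIso_hom_comp_hypersurfaceι (ψ : ℂ) (a : Fin 6 → ℂ) (ha : ∀ i, a i ^ 6 = 1)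
    (hprod : ∏ i, a i = 1) :
    (diagIso ψ a ha hprod).hom ≫ Motives.SmoothHypersurface.hypersurfaceι (form ψ) =
      Motives.SmoothHypersurface.hypersurfaceι (form ψ) ≫
        ProjectiveSpace.diagMap a (ne_zero_of_pow_six ha) :=
  Motives.SmoothHypersurface.substLift_comp_hypersurfaceι _ _ _ _ _ _ (aeval_diagSubst_form ψ ha hprod)

/-- **The algebraic symmetry acts on `X_ψ(ℂ)` by `[x] ↦ [a • x]`**: the continuous self-map
`(diagIso ψ a).hom(ℂ)` realises `a` in homogeneous coordinates (the shape of `HasSymmetry ψ`).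
[cite: Katz2009, §3] -/
theorem exists_rep_pt_diagIso (ψ : ℂ) (a : Fin 6 → ℂ) (ha : ∀ i, a i ^ 6 = 1)
    (hprod : ∏ i, a i = 1) (x : Motives.ComplexPoints (fibre ψ)) :
    ∃ t : ℂ, (pt ψ (Motives.AlgPoints.mapContinuous (diagIso ψ a ha hprod).hom x)).rep =
      t • (a * (pt ψ x).rep) := by
  obtain ⟨t, -, h⟩ := exists_rep_hypersurfacePoint_map_of_comp_eq (ProjectiveSpace.diagSubst a)
    (ProjectiveSpace.isHomogeneous_diagSubst a) (ProjectiveSpace.diagSubst fun j => (a j)⁻¹)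
    (ProjectiveSpace.isHomogeneous_diagSubst _)
    (ProjectiveSpace.aeval_diagSubst_diagSubst_inv (ne_zero_of_pow_six ha))
    (Motives.SmoothHypersurface.hypersurfaceι (form ψ)) (diagIso ψ a ha hprod).hom
    (diagIso_hom_comp_hypersurfaceι ψ a ha hprod) x
  refine ⟨t, h.trans ?_⟩
  rw [ProjectiveSpace.substVec_diagSubst]
  rfl

/-- **Every continuous self-map of `X_ψ(ℂ)` realising `a ∈ Γ_W` is algebraic**: it is the map on
complex points of the `ℂ`-automorphism `diagIso ψ a` (uniqueness of the realising map,
`symmetry_unique`). In particular the maps quantified over in `IsEig ψ e` / provided by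
`HasSymmetry ψ` are analytifications of automorphisms of the `ℂ`-scheme `X_ψ`. [cite: Katz2009, §3] -/
theorem eq_mapContinuous_diagIso (ψ : ℂ) {a : Fin 6 → ℂ} (ha : ∀ i, a i ^ 6 = 1)
    (hprod : ∏ i, a i = 1) {g : C(Motives.ComplexPoints (fibre ψ), Motives.ComplexPoints (fibre ψ))}
    (hg : ∀ x, ∃ t : ℂ, (pt ψ (g x)).rep = t • (a * (pt ψ x).rep)) :
    g = Motives.AlgPoints.mapContinuous (diagIso ψ a ha hprod).hom :=
  symmetry_unique ψ hg (exists_rep_pt_diagIso ψ a ha hprod)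

end DworkSextic

end Literature.AlgebraicGeometry.HodgeTheory

end
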